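import Literature.AlgebraicGeometry.Resolution.QuadraticTransformsRegular
import Literature.AlgebraicGeometry.Resolution.DominatedUnions
import Literature.AlgebraicGeometry.Resolution.KrullAkizukiLemma
import Mathlib.RingTheory.KrullDimension.Polynomial
import Mathlib.RingTheory.KrullDimension.NonZeroDivisors
import Mathlib.RingTheory.Ideal.Height
import Mathlib.RingTheory.Localization.Submodule
import HarnessLib

/-!
# Abhyankar's union lemma for quadratic transforms — proof (Abhyankar 1956, Lemma 12)

Topic: `Literature/AlgebraicGeometry/Resolution`. DISCHARGE of the named fact
`AbhyankarQuadraticUnion` of `QuadraticTransforms.lean` (Cutkosky 2014, Lemma 2.2 = Abhyankar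
1956, Lemma 12): if `R = R₀ → R₁ → ⋯` is the sequence of quadratic transforms of a
two-dimensional regular local ring `R` of the field `K` along a valuation ring `O` dominating
`R`, then `O = ⋃ Rᵢ`.

## The proof (Abhyankar 1956: Lemma 7, Theorem 1, Proposition 8 ⇒ Lemma 12)

Every `Rᵢ` lies in `O` (trivial inclusion). Conversely it suffices that `U := ⋃ Rᵢ` be a
valuation ring of `K`: `O` dominates `U`, and a valuation ring dominated by a local subring with
the same fraction field equals it (if `z ∈ O`, `z⁻¹ ∈ Rᵢ` then `z = (z⁻¹)⁻¹ ∈ Rᵢ` by domination).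
Suppose `t, t⁻¹ ∉ U`.
1. Each `Rᵢ` is a regular local ring (`QuadraticTransformsRegular.lean`), hence integrally closed
   in `K`, and is dominated by `R_{i+1}`; by **Lemma 7** (`DominatedUnions.lean`) there is a
   valuation ring `W ∋ t` of `K` dominating every `Rᵢ` in whose residue field `t̄` is
   transcendental over `κ(R₀)`.
2. **Theorem 1 in dimension two** (`exists_oneDim_between`): `B := R₀[t] ⊆ W` is a Noetherian
   domain of dimension `≤ 2` (`B ≅ R₀[X]/𝔭` with `𝔭 ∋ bX − a ≠ 0`, `dim R₀[X] = 3`); the centre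
   `P = m_W ∩ B` of `W` on `B` is a nonzero prime which is not maximal (`B/P ≅ κ(R₀)[X]`:
   `t ∉ P` and `P + tB ≠ B` by transcendence), so `ht P ≤ 1` and `S := B_P ⊆ W` is a Noetherian
   local domain of dimension `≤ 1` containing `R₀`, with `Frac S = K`.
3. By the **Krull–Akizuki lemma** (`KrullAkizukiLemma.lean`,
   `not_strictMono_valuation_of_krullDimLE_one`) `W` admits no sequence of elements whose values
   strictly decrease while staying `≥ w(a)` for a fixed `0 ≠ a ∈ S`.
4. **Proposition 8** (descent, `exists_descent_sequence`): write `t = y₀/z₀`, `y₀, z₀ ∈ R₀`;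
   since `t, t⁻¹ ∉ Rᵢ` both `yᵢ, zᵢ ∈ mᵢ ⊆ xᵢ R_{i+1}` (`xᵢ` the generator of minimal value), so
   `t = y_{i+1}/z_{i+1}` with `y_{i+1} = yᵢ/xᵢ ∈ R_{i+1}` and `w(y_{i+1}) < w(yᵢ)` as `w(xᵢ) > 0`
   (`W` dominates `Rᵢ`) — a sequence forbidden by 3 (with `a = y₀`). Hence `U` is a valuation
   ring, and `O = U`.

## Sources

* S. D. Cutkosky, *Counterexamples to local monomialization in positive characteristic*,
  Math. Ann. 362 (2015), Lemma 2.2. [cite: Cutkosky2014, Lemma 2.2]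
* S. S. Abhyankar, *On the valuations centered in a local domain*, Amer. J. Math. 78 (1956),
  Lemma 12 (with Lemma 7, Thm. 1, Prop. 8; statements as reported by Cutkosky, Lemma 2.2, and
  Huneke–Swanson, Thm. 6.6.7, Ex. 6.24, Ex. 9.8). [cite: Abhyankar1956Valuations, Lemma 12]
* S. S. Abhyankar, *Ramification theoretic methods in algebraic geometry* (1959), Prop. 4.4 and
  Lemma 4.5 (the algebraic case, same architecture). [cite: Abhyankar1959, Lemma 4.5]
-/

noncomputable section

namespace Literature.AlgebraicGeometry.Resolution

universe u

variable {K : Type u} [Field K]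

open IsLocalRing Polynomial

/-! ## Generalities on subrings of `K` -/

/-- A subring containing a subring with fraction field `K` has fraction field `K`. [folklore] -/
theorem isFractionRing_of_isLocalRingOf_le {A B : Subring K}
    (hA : ∀ z : K, ∃ a ∈ A, ∃ b ∈ A, b ≠ 0 ∧ z = a / b) (hAB : A ≤ B) : IsFractionRing B K := by
  refine IsFractionRing.of_field B K fun z => ?_
  obtain ⟨a, ha, b, hb, -, rfl⟩ := hA z
  exact ⟨⟨a, hAB ha⟩, ⟨b, hAB hb⟩, rfl⟩

/-- If `W` dominates the local subring `A` then a nonzero non-unit of `A` has value `< 1`.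
[folklore] -/
theorem valuation_lt_one_of_subringDominates {A : Subring K} {W : ValuationSubring K}
    (h : SubringDominates A W.toSubring) {x : K} (hx : x ∈ A) (hxinv : x⁻¹ ∉ A) :
    W.valuation x < 1 := by
  have hx0 : x ≠ 0 := by
    rintro rfl
    exact hxinv (by rw [inv_zero]; exact A.zero_mem)
  rcases ((W.valuation_le_one_iff x).mpr (h.1 hx)).lt_or_eq with hlt | heq
  · exact hlt
  · exfalso
    refine hxinv (h.2 x hx ?_)
    change x⁻¹ ∈ W
    rw [← W.valuation_le_one_iff, map_inv₀, heq, inv_one]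

/-! ## Abhyankar's Theorem 1 in dimension two: a one-dimensional ring between `R₀` and `W` -/

/-- **Abhyankar 1956, Thm. 1, the case used by Lemma 12** (dimension two, residue transcendence
degree one), in the form: let `R₀ ⊆ K` be a Noetherian local subring of Krull dimension `2`
with fraction field `K` and a nonzero non-unit `x₀`, `W` a valuation ring of `K` dominating `R₀`,
and `t ∈ W` such that
every `p ∈ R₀[X]` with `w(p(t)) > 0` has no unit coefficient (the residue of `t` is
transcendental over `κ(R₀)`). Then there is a subring `S` with `R₀ ⊆ S ⊆ W` which is a Noetherian
domain of Krull dimension `≤ 1` — namely `S = R₀[t]_{m_W ∩ R₀[t]}`: `R₀[t] ≅ R₀[X]/𝔭` with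
`0 ≠ 𝔭` has dimension `≤ 2` (`dim R₀[X] = 3`), and `m_W ∩ R₀[t]` is a nonzero non-maximal
prime. (Abhyankar/Huneke–Swanson then conclude with Krull–Akizuki that `w` is discrete of rank
one; we consume `S` directly in `KrullAkizukiLemma.lean`.)
[cite: Abhyankar1956Valuations, Thm. 1] -/
theorem exists_oneDim_between (R₀ : Subring K) [IsLocalRing R₀] [IsNoetherianRing R₀]
    (hdim : ringKrullDim R₀ = 2) (hof : ∀ z : K, ∃ a ∈ R₀, ∃ b ∈ R₀, b ≠ 0 ∧ z = a / b)
    {x₀ : K} (hx₀ : x₀ ∈ R₀) (hx₀0 : x₀ ≠ 0) (hx₀inv : x₀⁻¹ ∉ R₀)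
    (W : ValuationSubring K) (hW : SubringDominates R₀ W.toSubring) {t : K} (htW : t ∈ W)
    (htrans : ∀ p : R₀[X], W.valuation (aeval t p) < 1 → ∀ j, ¬ IsUnit (p.coeff j)) :
    ∃ S : Subring K, R₀ ≤ S ∧ S ≤ W.toSubring ∧ IsNoetherianRing S ∧ ringKrullDim S ≤ 1 := by
  classical
  -- `B = R₀[t] ⊆ W`
  set ev : R₀[X] →+* K := (aeval (R := R₀) t).toRingHom with hev
  have hev_apply : ∀ p : R₀[X], ev p = aeval t p := fun p => rfl
  set B : Subring K := ev.range with hB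
  have hR₀B : R₀ ≤ B := fun x hx => ⟨C ⟨x, hx⟩, by rw [hev_apply, aeval_C]; rfl⟩
  have htB : t ∈ B := ⟨X, by rw [hev_apply, aeval_X]⟩
  have hBW : B ≤ W.toSubring := by
    rintro _ ⟨p, rfl⟩
    rw [hev_apply]
    refine Polynomial.induction_on' p (fun p q hp hq => ?_) (fun n c => ?_)
    · rw [map_add]; exact add_mem hp hq
    · rw [aeval_monomial]; exact mul_mem (hW.1 c.2) (pow_mem htW n)
  -- `B` is a Noetherian domain of dimension `≤ 2`
  haveI hBnoeth : IsNoetherianRing B := by rw [hB]; infer_instance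
  obtain ⟨a, ha, b, hb, hb0, htab⟩ := hof t
  set p₀ : R₀[X] := C ⟨b, hb⟩ * X - C ⟨a, ha⟩ with hp₀
  have hp₀t : aeval t p₀ = 0 := by
    rw [hp₀, map_sub, map_mul, aeval_C, aeval_X, aeval_C, htab]
    change (b : K) * (a / b) - a = 0
    rw [mul_div_cancel₀ a hb0, sub_self]
  have hp₀0 : p₀ ≠ 0 := by
    intro h
    have h1 : p₀.coeff 1 = ⟨b, hb⟩ := by
      simp [hp₀, coeff_C]
    rw [h, coeff_zero] at h1
    exact hb0 (congrArg Subtype.val h1).symm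
  have hdimB : ringKrullDim B ≤ 2 := by
    set ev' : R₀[X] →+* B := ev.rangeRestrict with hev'
    have hsurj : Function.Surjective ev' := RingHom.rangeRestrict_surjective ev
    have hkill : ∀ q ∈ Ideal.span {p₀}, ev' q = 0 := by
      intro q hq
      obtain ⟨c, rfl⟩ := Ideal.mem_span_singleton'.mp hq
      apply Subtype.ext
      change ev (c * p₀) = 0
      rw [map_mul, hev_apply p₀, hp₀t, mul_zero]
    set g : R₀[X] ⧸ Ideal.span {p₀} →+* B := Ideal.Quotient.lift _ ev' hkill with hg
    have hgsurj : Function.Surjective g := by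
      intro y
      obtain ⟨q, rfl⟩ := hsurj y
      exact ⟨Ideal.Quotient.mk _ q, Ideal.Quotient.lift_mk _ _ _⟩
    have h1 : ringKrullDim B ≤ ringKrullDim (R₀[X] ⧸ Ideal.span {p₀}) :=
      ringKrullDim_le_of_surjective g hgsurj
    have h2 : ringKrullDim (R₀[X] ⧸ Ideal.span {p₀}) + 1 ≤ ringKrullDim R₀[X] :=
      ringKrullDim_quotient_succ_le_of_nonZeroDivisor (mem_nonZeroDivisors_of_ne_zero hp₀0)
    rw [Polynomial.ringKrullDim_of_isNoetherianRing, hdim] at h2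
    exact h1.trans (ENat.WithBot.add_le_add_one_right_iff.mp h2)
  -- the centre `P` of `W` on `B`: a nonzero, non-maximal prime
  set P : Ideal B := subringCentre B W hBW with hP
  have hmemP : ∀ x : B, x ∈ P ↔ W.valuation (x : K) < 1 := mem_subringCentre_iff hBW
  haveI hPprime : P.IsPrime := subringCentre.isPrime B W hBW
  have hPbot : P ≠ ⊥ := by
    refine (Submodule.ne_bot_iff _).mpr ⟨⟨x₀, hR₀B hx₀⟩, ?_, fun h => hx₀0 (congrArg Subtype.val h)⟩
    exact (hmemP _).mpr (valuation_lt_one_of_subringDominates hW hx₀ hx₀inv)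
  have htval : W.valuation t = 1 := by
    rcases ((W.valuation_le_one_iff t).mpr htW).lt_or_eq with hlt | heq
    · exfalso
      refine htrans X (by rwa [aeval_X]) 1 ?_
      rw [coeff_X_one]
      exact isUnit_one
    · exact heq
  have htP : (⟨t, htB⟩ : B) ∉ P := by
    rw [hmemP]
    exact fun h => (ne_of_lt h) htval
  have hPt : P ⊔ Ideal.span {(⟨t, htB⟩ : B)} ≠ ⊤ := by
    intro htop
    obtain ⟨p, hp, q, hq, hpq⟩ := Submodule.mem_sup.mp ((Ideal.eq_top_iff_one _).mp htop)
    obtain ⟨c, rfl⟩ := Ideal.mem_span_singleton'.mp hq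
    -- `p = 1 - c t` has value `< 1`; write `c = q̃(t)` and look at `1 - X q̃`
    obtain ⟨q₁, hq₁⟩ := c.2
    have hpval : W.valuation (aeval t (1 - X * q₁)) < 1 := by
      have hp' : (p : K) = 1 - (c : K) * t := by
        have := congrArg Subtype.val hpq
        simp only [Subring.coe_add, Subring.coe_mul, Subring.coe_one] at this
        linear_combination this
      have : aeval t (1 - X * q₁) = (p : K) := by
        rw [map_sub, map_one, map_mul, aeval_X, hp', ← hev_apply, hq₁, mul_comm]
      rw [this]
      exact (hmemP p).mp hp
    refine htrans (1 - X * q₁) hpval 0 ?_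
    rw [coeff_sub, coeff_one_zero, mul_coeff_zero, coeff_X_zero, zero_mul, sub_zero]
    exact isUnit_one
  obtain ⟨M, hMmax, hPM⟩ := Ideal.exists_le_maximal _ hPt
  have hPltM : P < M := by
    refine lt_of_le_of_ne (le_sup_left.trans hPM) fun hPM' => htP ?_
    rw [hPM']
    exact hPM (Ideal.mem_sup_right (Ideal.mem_span_singleton_self _))
  have hPheight : P.height ≤ 1 := by
    haveI := hMmax.isPrime
    have h1 : P.height + 1 ≤ M.height := Ideal.height_add_one_le_of_lt_of_isPrime hPltM
    have h2 : (M.height : WithBot ℕ∞) ≤ 2 := (Ideal.height_le_ringKrullDim_of_isPrime).trans hdimB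
    have h2' : M.height ≤ 2 := WithBot.coe_le_coe.mp h2
    have h3 : P.height + 1 ≤ 1 + 1 := h1.trans (h2'.trans (le_of_eq one_add_one_eq_two.symm))
    exact (ENat.add_le_add_iff_right ENat.one_ne_top).mp h3
  -- `S = B_P` inside `K`
  refine ⟨locAtCentre B W, hR₀B.trans (le_locAtCentre B W), locAtCentre_le hBW, ?_, ?_⟩
  · haveI := isLocalization_locAtCentre hBW
    exact IsLocalization.isNoetherianRing P.primeCompl (locAtCentre B W) hBnoeth
  · haveI := isLocalization_locAtCentre hBW
    rw [IsLocalization.AtPrime.ringKrullDim_eq_height P (locAtCentre B W)]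
    exact_mod_cast hPheight

/-! ## Abhyankar's Proposition 8: the descent along the sequence -/

section Sequence

variable {O : ValuationSubring K} {R : ℕ → Subring K}

/-- Along the sequence, each `m_i` lies in `x_i R_{i+1}` for some nonzero non-unit `x_i ∈ R_i`
(the generator of minimal value of the chart). [cite: Cutkosky2014, §2.2] -/
theorem exists_generator_of_step (hstep : ∀ i, IsQuadraticTransformAlong O (R i) (R (i + 1)))
    (i : ℕ) : ∃ x : K, x ∈ R i ∧ x ≠ 0 ∧ x⁻¹ ∉ R i ∧
      ∀ y ∈ R i, y⁻¹ ∉ R i → y / x ∈ R (i + 1) := by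
  obtain ⟨_, x, hxm, hx0, -, hR⟩ := (hstep i).exists_eq_locAtCentre
  refine ⟨x, x.2, fun h => hx0 (Subtype.ext h), ?_, fun y hy hyinv => ?_⟩
  · exact fun h => ((mem_maximalIdeal_iff_inv_not_mem x).mp hxm).elim
      (fun h0 => hx0 (Subtype.ext h0)) (· h)
  · have hym : (⟨y, hy⟩ : R i) ∈ maximalIdeal (R i) := by
      rw [mem_maximalIdeal_iff_inv_not_mem]
      exact Or.inr hyinv
    rw [hR]
    exact le_locAtCentre _ O (div_mem_blowupRing (x : K) hym)

/-- **Abhyankar 1956, Prop. 8 (the descent).** Let `R₀ → R₁ → ⋯` be quadratic transforms along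
`O` and `t ∈ K` with `t ∉ Rᵢ`, `t⁻¹ ∉ Rᵢ` for all `i`. Writing `t = y₀/z₀` with `y₀, z₀ ∈ R₀`,
there are `yᵢ ∈ Rᵢ` with `y_{i+1} = yᵢ/xᵢ` for nonzero non-units `xᵢ ∈ Rᵢ` ("since `v` has
center `Mᵢ` in `Rᵢ` we have `yᵢ, zᵢ ∈ Mᵢ`, so `y_{i+1} = yᵢ/xᵢ ∈ R_{i+1}`"): a sequence in
`⋃ Rᵢ` starting at `y₀` whose values under any valuation dominating all the `Rᵢ` strictly
decrease. [cite: Abhyankar1956Valuations, Prop. 8] [cite: Abhyankar1959, Prop. 4.4] -/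
theorem exists_descent_sequence (hstep : ∀ i, IsQuadraticTransformAlong O (R i) (R (i + 1)))
    {t : K} (ht : ∀ i, t ∉ R i) (ht' : ∀ i, t⁻¹ ∉ R i) {y₀ z₀ : K} (hy₀ : y₀ ∈ R 0)
    (hz₀ : z₀ ∈ R 0) (htyz : t = y₀ / z₀) :
    ∃ (y x : ℕ → K), y 0 = y₀ ∧ (∀ i, y i ∈ R i) ∧
      (∀ i, x i ∈ R i ∧ x i ≠ 0 ∧ (x i)⁻¹ ∉ R i) ∧ ∀ i, y (i + 1) = y i / x i := by
  classical
  choose x hxR hx0 hxinv hxdiv using exists_generator_of_step hstep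
  -- `yᵢ = y₀ / (x₀ ⋯ x_{i-1})`, `zᵢ = z₀ / (x₀ ⋯ x_{i-1})`
  set y : ℕ → K := fun i => y₀ / ∏ j ∈ Finset.range i, x j with hy
  set z : ℕ → K := fun i => z₀ / ∏ j ∈ Finset.range i, x j with hz
  have hprod : ∀ i, ∏ j ∈ Finset.range i, x j ≠ 0 := fun i =>
    Finset.prod_ne_zero_iff.mpr fun j _ => hx0 j
  have hy0 : y 0 = y₀ := by simp [hy]
  have hysucc : ∀ i, y (i + 1) = y i / x i := by
    intro i
    simp only [hy]
    rw [Finset.prod_range_succ, div_div]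
  have hzsucc : ∀ i, z (i + 1) = z i / x i := by
    intro i
    simp only [hz]
    rw [Finset.prod_range_succ, div_div]
  have ht_eq : ∀ i, t = y i / z i := by
    intro i
    simp only [hy, hz]
    rw [div_div_div_cancel_right₀ (hprod i), htyz]
  have hmem : ∀ i, y i ∈ R i ∧ z i ∈ R i := by
    intro i
    induction i with
    | zero =>
      constructor
      · rw [hy0]; exact hy₀
      · simp only [hz, Finset.range_zero, Finset.prod_empty, div_one]; exact hz₀
    | succ i ih =>
      obtain ⟨hyi, hzi⟩ := ih
      -- `yᵢ, zᵢ` are non-units of `Rᵢ` since `t, t⁻¹ ∉ Rᵢ`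
      have hzinv : (z i)⁻¹ ∉ R i := fun h => ht i (by
        rw [ht_eq i, div_eq_mul_inv]
        exact (R i).mul_mem hyi h)
      have hyinv : (y i)⁻¹ ∉ R i := fun h => ht' i (by
        rw [ht_eq i, inv_div, div_eq_mul_inv]
        exact (R i).mul_mem hzi h)
      rw [hysucc, hzsucc]
      exact ⟨hxdiv i (y i) hyi hyinv, hxdiv i (z i) hzi hzinv⟩
  exact ⟨y, x, hy0, fun i => (hmem i).1, fun i => ⟨hxR i, hx0 i, hxinv i⟩, hysucc⟩

/-- **The union of the sequence is a valuation ring of `K`** (Abhyankar 1956, Lemma 12, main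
step; Abhyankar 1959, Lemma 4.5): for the sequence of quadratic transforms along `O` of a
two-dimensional regular local ring `R₀` of `K` dominated by `O`, every `t ∈ K` has `t ∈ Rᵢ` or
`t⁻¹ ∈ Rᵢ` for some `i`. Proof: otherwise Lemma 7 gives `W ∋ t` dominating all `Rᵢ` with `t̄`
transcendental; Theorem 1 (dimension two) gives a one-dimensional Noetherian `R₀ ⊆ S ⊆ W`; the
descent of Prop. 8 produces values `w(y₀) > w(y₁) > ⋯` bounded by `w(y₀)`, `y₀ ∈ S`,
contradicting the Krull–Akizuki lemma. [cite: Abhyankar1956Valuations, Lemma 12]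
[cite: Abhyankar1959, Lemma 4.5] -/
theorem mem_or_inv_mem_sequence (hreg : IsRegularLocalRing (R 0)) (hdim : ringKrullDim (R 0) = 2)
    (hof : IsLocalRingOf (R 0)) (h0 : SubringDominates (R 0) O.toSubring)
    (hstep : ∀ i, IsQuadraticTransformAlong O (R i) (R (i + 1))) (t : K) :
    (∃ i, t ∈ R i) ∨ ∃ i, t⁻¹ ∈ R i := by
  classical
  by_contra hcon
  rw [not_or, not_exists, not_exists] at hcon
  obtain ⟨ht, ht'⟩ := hcon
  -- the members are regular local rings dominated by their successors, normal, with `Frac = K`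
  have hregi : ∀ i, IsRegularLocalRing (R i) := isRegularLocalRing_sequence hreg hstep
  have hloc : ∀ i, IsLocalRing (R i) := fun i => (hregi i).toIsLocalRing
  have hdomO : ∀ i, SubringDominates (R i) O.toSubring := fun i => (sequence_dominates h0 hstep i).1
  have hdom : ∀ i, SubringDominates (R i) (R (i + 1)) := fun i =>
    ((hstep i).isQuadraticTransform (hdomO i)).dominates
  have hmono : Monotone R := sequence_monotone hstep
  have hfrac : ∀ i, IsFractionRing (R i) K := fun i =>
    isFractionRing_of_isLocalRingOf_le hof.2 (hmono (Nat.zero_le i))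
  have hint : ∀ i, IsIntegrallyClosedIn (R i) K := fun i => by
    haveI := hregi i
    haveI := hfrac i
    exact isIntegrallyClosedIn_of_isRegularLocalRing (R i)
  -- Lemma 7
  obtain ⟨W, htW, hWdom, htrans⟩ :=
    exists_valuationSubring_dominates_of_chain' R hloc hdom hint ht ht'
  -- Theorem 1 (dimension two)
  haveI := hregi 0
  obtain ⟨x₀, hx₀, hx₀0, hx₀inv, -⟩ := exists_generator_of_step hstep 0
  obtain ⟨S, hR₀S, hSW, hSnoeth, hSdim⟩ :=
    exists_oneDim_between (R 0) hdim hof.2 hx₀ hx₀0 hx₀inv W (hWdom 0) htW (htrans 0)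
  -- Proposition 8 (descent) from `t = y₀ / z₀`
  obtain ⟨y₀, hy₀, z₀, hz₀, -, htyz⟩ := hof.2 t
  obtain ⟨y, x, hy0, hyR, hx, hysucc⟩ := exists_descent_sequence hstep ht ht' hy₀ hz₀ htyz
  have ht0 : t ≠ 0 := fun h => ht 0 (h ▸ (R 0).zero_mem)
  have hy_ne : ∀ i, y i ≠ 0 := by
    intro i
    induction i with
    | zero =>
      rw [hy0]
      rintro rfl
      rw [zero_div] at htyz
      exact ht0 htyz
    | succ i ih => rw [hysucc]; exact div_ne_zero ih (hx i).2.1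
  -- the values `w(yᵢ)` strictly increase (multiplicative notation)
  have hmonoW : ∀ i, W.valuation (y i) < W.valuation (y (i + 1)) := by
    intro i
    obtain ⟨hxi, hxi0, hxiinv⟩ := hx i
    have hvx : W.valuation (x i) < 1 := valuation_lt_one_of_subringDominates (hWdom i) hxi hxiinv
    have hvx0 : W.valuation (x i) ≠ 0 := (_root_.map_ne_zero _).mpr hxi0
    have hvy0 : W.valuation (y i) ≠ 0 := (_root_.map_ne_zero _).mpr (hy_ne i)
    rw [hysucc, map_div₀, lt_div_iff₀ (pos_iff_ne_zero.mpr hvx0)]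
    have := mul_lt_mul_of_lt_of_le_of_nonneg_of_pos hvx (le_refl (W.valuation (y i))) zero_le
      (pos_iff_ne_zero.mpr hvy0)
    rwa [one_mul, mul_comm] at this
  -- Krull–Akizuki on `S`
  haveI : IsNoetherianRing S := hSnoeth
  haveI : Ring.KrullDimLE 1 S := Ring.krullDimLE_iff.mpr (by exact_mod_cast hSdim)
  haveI : IsFractionRing S K := isFractionRing_of_isLocalRingOf_le hof.2 hR₀S
  have hSW' : ∀ s : S, algebraMap S K s ∈ W := fun s => hSW s.2
  have hd : (⟨y₀, hR₀S hy₀⟩ : S) ≠ 0 := fun h => hy_ne 0 (by rw [hy0]; exact congrArg Subtype.val h)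
  refine not_strictMono_valuation_of_krullDimLE_one W hSW' hd y (fun i => (hWdom i).1 (hyR i)) ?_
    hmonoW
  change W.valuation y₀ ≤ W.valuation (y 0)
  rw [hy0]

end Sequence

/-! ## The discharge -/

/-- DISCHARGE of `AbhyankarQuadraticUnion` — **Abhyankar's union lemma** (Cutkosky 2014,
Lemma 2.2 = Abhyankar 1956, Lemma 12): for a two-dimensional regular local ring `R` of a field
`K`, a valuation ring `O` of `K` dominating `R`, and the sequence `R = R₀ → R₁ → ⋯` of quadratic
transforms along `O`, `O = ⋃ Rᵢ`. The inclusion `⋃ Rᵢ ⊆ O` is by construction; conversely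
`⋃ Rᵢ` is a valuation ring (`mem_or_inv_mem_sequence`) dominated by `O`, hence equal to `O`.
[cite: Cutkosky2014, Lemma 2.2] [cite: Abhyankar1956Valuations, Lemma 12] -/
theorem AbhyankarQuadraticUnion_holds : AbhyankarQuadraticUnion.{u} := by
  intro K _ O R hreg hdim hof h0 hstep z
  constructor
  · intro hz
    rcases mem_or_inv_mem_sequence hreg hdim hof h0 hstep z with ⟨i, hi⟩ | ⟨i, hi⟩
    · exact ⟨i, hi⟩
    · by_cases hz0 : z = 0
      · exact ⟨0, hz0 ▸ (R 0).zero_mem⟩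
      · refine ⟨i, ?_⟩
        have h := (sequence_dominates h0 hstep i).1.2 z⁻¹ hi
        rw [inv_inv] at h
        exact h hz
  · rintro ⟨i, hi⟩
    exact (sequence_dominates h0 hstep i).1.1 hi

end Literature.AlgebraicGeometry.Resolution

end
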